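import Literature.Analysis.SpecialFunctions.RiemannThetaLefschetz
import HarnessLib

/-!
# Lefschetz's theorem for `ϑ(·, Ω)`: the three analytic steps, as printed

Let `Ω ∈ 𝔥ₙ` (`Ω` symmetric, `Im Ω` positive definite) and `ϑ = ϑ(·, Ω)` the Riemann theta function
(`Literature.Analysis.SpecialFunctions.riemannTheta`). The proof of **Lefschetz's theorem** for the
principally polarised torus `ℂⁿ/(ℤⁿ ⊕ Ωℤⁿ)` (Lange–Birkenhake, *Complex Abelian Varieties*,
Thm. 4.5.1, Steps I–III; Mumford, *Abelian Varieties* §17; Griffiths–Harris Ch. 2 §6) works with the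
products `s_{a,b} = ϑ(· + a) ϑ(· + b) ϑ(· - a - b)` (sections of the cube of the theta bundle) and
consists of three analytic statements about `ϑ`:

* `riemannTheta_not_identically_zero` — Step I: `ϑ ≢ 0`;
* `riemannTheta_cubic_separatesPoints` — Step II: if the values at `z₂` of ALL the products `s_{a,b}`
  are a common multiple `c` of their values at `z₁`, then `z₂ - z₁ ∈ ℤⁿ ⊕ Ωℤⁿ`;
* `riemannTheta_cubic_separatesTangents` — Step III: if the derivatives along `t` at `z` of ALL the
  products `s_{a,b}` are a common multiple `c` of their values at `z`, then `t = 0`.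

They are stated here in the exact typing of the registered stubs `stub_thetaNonvanishing`,
`stub_thetaSeparatesPoints`, `stub_thetaSeparatesTangents` of crux `RiemannWeightOne`
(stmt-HodgeConjecture-16406, route `SecondaryPeriods`), and are corollaries of the tree theorems
`exists_riemannTheta_ne_zero` (`RiemannThetaNonvanishing`: `∫_{[0,1]ⁿ} ϑ = 1`),
`riemannTheta_lattice_of_cubic_translate` and `riemannTheta_tangent_of_cubic_leibniz`
(`RiemannThetaLefschetz`: rigidity of the cubic identities + comparison of quasi-periods). The fourth
stub `stub_thetaAssembly` / `stub_thetaEmbedding` is `Literature.Geometry.Kaehler.siegelTorus_thetaEmbedding`.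

Everything is proved; no definitions, no named facts.

## References

* [LangeBirkenhake1992] H. Lange, Ch. Birkenhake, Complex Abelian Varieties (1992), Thm. 4.5.1.
* [MumfordAV1970] D. Mumford, Abelian Varieties (1970), §17 (Theorem of Lefschetz).
* [GriffithsHarris1978] P. Griffiths, J. Harris, Principles of Algebraic Geometry (1978), Ch. 2 §6.
* [MumfordTata1] D. Mumford, Tata Lectures on Theta I (1983), Ch. II §1.
-/

noncomputable section

open Complex

namespace Literature.Analysis.SpecialFunctions

/-- **Step I: `ϑ(·, Ω) ≢ 0`** for `Ω` symmetric with `Im Ω` positive definite (the Fourier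
coefficient `∫_{[0,1]ⁿ} ϑ(x) dx` equals `1`). Typing of stub `stub_thetaNonvanishing`.
[cite: MumfordTata1, Ch. II §1] [cite: LangeBirkenhake1992, §3.2] -/
theorem riemannTheta_not_identically_zero :
    ∀ ⦃n : ℕ⦄ (Ω : Matrix (Fin n) (Fin n) ℂ), (∀ i j, Ω i j = Ω j i) → (Ω.map Complex.im).PosDef →
      ∃ z : Fin n → ℂ, riemannTheta Ω z ≠ 0 := by
  intro n Ω _ hpos
  obtain ⟨c, hc, hY⟩ := exists_pos_mul_sum_sq_le_of_posDef_im Ω hpos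
  exact exists_riemannTheta_ne_zero Ω hc hY

/-- **Step II (the theta products separate points modulo the lattice).** If for two points `z₁, z₂`
and a constant `c` one has `ϑ(z₂+a)ϑ(z₂+b)ϑ(z₂-a-b) = c · ϑ(z₁+a)ϑ(z₁+b)ϑ(z₁-a-b)` for all `a, b`,
then `z₂ - z₁ = p + Ωq` with `p, q ∈ ℤⁿ`. Typing of stub `stub_thetaSeparatesPoints`.
[cite: LangeBirkenhake1992, Thm. 4.5.1 (Step II)] [cite: MumfordAV1970, §17]
[cite: GriffithsHarris1978, Ch. 2 §6] -/
theorem riemannTheta_cubic_separatesPoints :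
    ∀ ⦃n : ℕ⦄ (Ω : Matrix (Fin n) (Fin n) ℂ), (∀ i j, Ω i j = Ω j i) → (Ω.map Complex.im).PosDef →
      (∃ z : Fin n → ℂ, riemannTheta Ω z ≠ 0) →
      ∀ (z₁ z₂ : Fin n → ℂ) (c : ℂ),
      (∀ a b : Fin n → ℂ,
        riemannTheta Ω (z₂ + a) * riemannTheta Ω (z₂ + b) * riemannTheta Ω (z₂ - a - b) =
          c * (riemannTheta Ω (z₁ + a) * riemannTheta Ω (z₁ + b) * riemannTheta Ω (z₁ - a - b))) →
      ∃ p q : Fin n → ℤ, z₂ - z₁ = fun i => (p i : ℂ) + ∑ j, Ω i j * (q j : ℂ) := by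
  intro n Ω hΩ hpos _ z₁ z₂ c h
  obtain ⟨c', hc', hY⟩ := exists_pos_mul_sum_sq_le_of_posDef_im Ω hpos
  obtain ⟨p, q, hpq⟩ := riemannTheta_lattice_of_cubic_translate Ω hΩ hc' hY h
  exact ⟨p, q, funext fun i => by rw [Pi.sub_apply]; exact hpq i⟩

/-- **Step III (the theta products separate tangent vectors).** If for a point `z`, a vector `t` and
a constant `c` one has `∂_t (ϑ(·+a)ϑ(·+b)ϑ(·-a-b))(z) = c · ϑ(z+a)ϑ(z+b)ϑ(z-a-b)` for all `a, b`,
then `t = 0`. Typing of stub `stub_thetaSeparatesTangents`.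
[cite: LangeBirkenhake1992, Thm. 4.5.1 (Step III)] [cite: MumfordAV1970, §17]
[cite: GriffithsHarris1978, Ch. 2 §6] -/
theorem riemannTheta_cubic_separatesTangents :
    ∀ ⦃n : ℕ⦄ (Ω : Matrix (Fin n) (Fin n) ℂ), (∀ i j, Ω i j = Ω j i) → (Ω.map Complex.im).PosDef →
      (∃ z : Fin n → ℂ, riemannTheta Ω z ≠ 0) →
      ∀ (z t : Fin n → ℂ) (c : ℂ),
      (∀ a b : Fin n → ℂ,
        fderiv ℂ (fun w => riemannTheta Ω (w + a) * riemannTheta Ω (w + b) * riemannTheta Ω (w - a - b))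
            z t =
          c * (riemannTheta Ω (z + a) * riemannTheta Ω (z + b) * riemannTheta Ω (z - a - b))) →
      t = 0 := by
  intro n Ω hΩ hpos _ z t c h
  obtain ⟨c', hc', hY⟩ := exists_pos_mul_sum_sq_le_of_posDef_im Ω hpos
  refine riemannTheta_tangent_of_cubic_leibniz Ω hΩ hc' hY (z := z) (v := t) (μ := c) fun a b => ?_
  rw [← h a b, (hasFDerivAt_riemannTheta_cubic Ω hc' hY a b z).fderiv]
  simp only [_root_.add_apply, FunLike.coe_smul, Pi.smul_apply, smul_eq_mul]
  ring

end Literature.Analysis.SpecialFunctions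

end
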